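import Mathlib.Computability.Language
import Mathlib.Algebra.Polynomial.Eval.Defs
import Literature.Computability.Cryptography.QubitRegister
import Literature.Computability.Cryptography.QuantumCircuit
import Literature.Computability.Cryptography.ClassBQP
import Literature.Computability.Complexity.BoolEncodings
import Literature.Computability.Complexity.Classes
import Literature.Computability.Complexity.Randomized
import Literature.Computability.Complexity.ProbabilisticClasses
import HarnessLib

-- provenance: harness21/H21/H21/Prelude/CryptoQuantFine/Postselection.lean @ 3d603bd (interim HEAD d8f2665); M5 mechanical rewrite
/-!
# Postselection: the classes PostBQP and PostBPP (trunk CryptoQuantFine, outline Q4)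

This prelude file realises the notion `postselection_postbqp` of the CryptoQuantFine outline on
top of Q2 (`QuantumCircuit`), Q3 (`ClassBQP`) and the complexity core G01 (`P`, `uniformProb`,
`boolPair`, `BPP`, `PP`):

* for a circuit `C` on `n + m` wires run on `|x⟩|0^m⟩`: `QCircuit.postselectProb` (probability
  that the *postselection wire* `1` reads `true`), `QCircuit.jointAcceptProb` (wires `0` and `1`
  both `true`), and the conditional acceptance probability
  `QCircuit.condAcceptProb = jointAcceptProb / postselectProb`; family versions
  `QCircuitFamily.postselectProbOn`, `jointAcceptProbOn`, `condAcceptProbOn` on classical inputs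
  `x : List Bool`;
* `PostBQP` (Aaronson 2005): bounded-error quantum polynomial time with postselection, over the
  gate set Clifford+T;
* `PostBPP` (= `BPP_path`, Han–Hemaspaandra–Thierauf 1997): its classical analogue, phrased with
  two languages `R, S ∈ P` (accept / postselect predicates on `boolPair x r`) and `uniformProb`,
  in multiplication form (no division);
* API (proofs may be `sorry`): `postselectProb_nonneg`, `jointAcceptProb_le_postselectProb`,
  `condAcceptProb_le_one`, `BQP_subset_PostBQP`, `BPP_subset_PostBPP`, `PostBPP_subset_PostBQP`,
  `PostBQP_eq_PP` (Aaronson's theorem).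

## Sources

* S. Aaronson, *Quantum computing, postselection, and probabilistic polynomial-time*,
  Proc. R. Soc. A 461 (2005), 3473–3482: Def. 1 (PostBQP), Thm. 2 (`PostBQP = PP`),
  §2 (`PostBPP = BPP_path ⊆ PostBQP`).
* Y. Han, L. Hemaspaandra, T. Thierauf, *Threshold computation and cryptographic security*,
  SIAM J. Comput. 26 (1997), §3 (`BPP_path`).
* G. Kuperberg, *How hard is it to approximate the Jones polynomial?*, Theory Comput. 11 (2015),
  §2.4 (gate-set dependence of `PostBQP` for non-algebraic amplitudes; robust for Clifford+T and
  any gate set with algebraic entries).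

## Mathlib

Used: `Language` (`0 = ∅` is the empty oracle), `Set`, `Polynomial.eval`, `Finset.sum`.
Mathlib has no postselection or complexity classes (searched: `PostBQP`, `PostBPP`, `postselect`,
`BPP_path`). From H21: `QCircuit`, `QCircuit.probEvent`, `QCircuit.runOn`, `basisState`,
`padInput`, `QCircuitFamily`, `IsOracleFree`, `IsUniform`, `cliffordT` (Q1/Q2); `BQP` (Q3); `P`
(G01 Classes); `uniformProb` (G01 Randomized); `boolPair` (G01 BoolEncodings); `BPP`, `PP`
(G01 ProbabilisticClasses).

## Design choices

* Wire `0` is the output wire (as in Q2's `acceptProb`) and wire `1` the postselection wire. The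
  probabilities are Born probabilities `QCircuit.probEvent` of the events `postselectEvent N`,
  `jointAcceptEvent N ⊆ QReg N`; on registers with fewer than two wires (`N < 2`) both events are
  empty and the probabilities are the junk value `0` (documented; the classes only use families
  with `0 < postselectProb`, which forces `2 ≤ N`).
* `condAcceptProb := jointAcceptProb / postselectProb` inherits Lean's `x / 0 = 0`; every
  statement using it (`PostBQP`) requires `0 < postselectProb` explicitly, as Aaronson's Def. 1
  does. `condAcceptProb_le_one` holds unconditionally (event inclusion), no unitarity needed.
* `PostBQP` fixes the gate set Clifford+T (`cliffordT`), as `BQP` does in Q3. *Caveat*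
  (Kuperberg 2015): with postselection the class is gate-set sensitive in general (exponentially
  small amplitudes can be manufactured from non-algebraic entries); for gate sets with algebraic
  entries, in particular Clifford+T, it equals `PP` (Aaronson 2005, Thm. 2).
* `PostBPP` is stated in the "random strings" style of G01's `bp` operator (outline D3): the
  postselect predicate `S` and the accept predicate `R` are languages in `P` read on
  `boolPair x r`, `r` uniform of length `p |x|`; the thresholds `2/3`, `1/3` on the conditional
  probability are written multiplicatively to avoid division.
* Class names are the customary acronyms (`PostBQP`, `PostBPP`), the documented deviation from
  lowerCamelCase shared with G01's `P`, `NP` and Q3's `BQP`.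
-/

open Computability Literature.Computability.Complexity Literature.Computability.Complexity.Classes

namespace Literature.Computability.Cryptography

variable {G : QGateSet} {n m : ℕ}

/-! ### Postselected acceptance probabilities of a circuit -/

namespace QCircuit

/-- The postselection event on an `N`-wire register: outcomes whose wire `1` (the postselection
flag) reads `true`. Empty if `N < 2` (junk case). [Aaronson 2005, Def. 1] [cite: Aaronson2005, Def. 1] -/
def postselectEvent (N : ℕ) : Set (QReg N) := {y | ∃ h : 1 < N, y ⟨1, h⟩ = true}

/-- The joint acceptance event on an `N`-wire register: outcomes whose output wire `0` and
postselection wire `1` both read `true`. Empty if `N < 2` (junk case). [Aaronson 2005, Def. 1] [cite: Aaronson2005, Def. 1] -/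
def jointAcceptEvent (N : ℕ) : Set (QReg N) :=
  {y | ∃ h : 1 < N, y ⟨0, by omega⟩ = true ∧ y ⟨1, h⟩ = true}

/-- The joint acceptance event is contained in the postselection event. [folklore] -/
theorem jointAcceptEvent_subset_postselectEvent (N : ℕ) :
    jointAcceptEvent N ⊆ postselectEvent N := by
  rintro y ⟨h, -, hy⟩
  exact ⟨h, hy⟩

/-- **Postselection probability.** For a circuit `C` on `n + m` wires run (relative to the oracle
`A`) on `|x⟩|0^m⟩`, the Born probability that the postselection wire `1` reads `true`:
`Pr[post = 1] = ∑_{y, y₁ = 1} |(U_C |x 0^m⟩)(y)|²`. Junk value `0` if `n + m < 2`.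
[Aaronson 2005, Def. 1] [cite: Aaronson2005, Def. 1] -/
noncomputable def postselectProb (A : Language Bool) (C : QCircuit G (n + m)) (x : QReg n) : ℝ :=
  C.probEvent A (basisState (padInput x m)) (postselectEvent (n + m))

/-- **Joint acceptance probability.** For a circuit `C` on `n + m` wires run (relative to the
oracle `A`) on `|x⟩|0^m⟩`, the Born probability that the output wire `0` and the postselection
wire `1` both read `true`: `Pr[out = 1 ∧ post = 1]`. Junk value `0` if `n + m < 2`.
[Aaronson 2005, Def. 1] [cite: Aaronson2005, Def. 1] -/
noncomputable def jointAcceptProb (A : Language Bool) (C : QCircuit G (n + m)) (x : QReg n) : ℝ :=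
  C.probEvent A (basisState (padInput x m)) (jointAcceptEvent (n + m))

/-- **Conditional (postselected) acceptance probability** `Pr[out = 1 | post = 1] =
Pr[out = 1 ∧ post = 1] / Pr[post = 1]` of a circuit on `n + m` wires run on `|x⟩|0^m⟩`.
Junk value: by Lean's convention `x / 0 = 0` this is `0` when `Pr[post = 1] = 0`; all uses
(`PostBQP`) require `0 < postselectProb` explicitly. [Aaronson 2005, Def. 1] [cite: Aaronson2005, Def. 1] -/
noncomputable def condAcceptProb (A : Language Bool) (C : QCircuit G (n + m)) (x : QReg n) : ℝ :=
  C.jointAcceptProb A x / C.postselectProb A x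

/-- Postselection probabilities are nonnegative. [Aaronson 2005, Def. 1] [cite: Aaronson2005, Def. 1] -/
theorem postselectProb_nonneg (A : Language Bool) (C : QCircuit G (n + m)) (x : QReg n) :
    0 ≤ C.postselectProb A x :=
  probEvent_nonneg A C _ _

/-- Joint acceptance probabilities are nonnegative. [Aaronson 2005, Def. 1] [cite: Aaronson2005, Def. 1] -/
theorem jointAcceptProb_nonneg (A : Language Bool) (C : QCircuit G (n + m)) (x : QReg n) :
    0 ≤ C.jointAcceptProb A x :=
  probEvent_nonneg A C _ _

/-- Born probabilities of events are monotone under inclusion (sums of nonnegative terms).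
[Nielsen–Chuang §2.2.5] [folklore] -/
theorem probEvent_mono {N : ℕ} (A : Language Bool) (C : QCircuit G N) (ψ : QReg N → ℂ)
    {E E' : Set (QReg N)} (h : E ⊆ E') : C.probEvent A ψ E ≤ C.probEvent A ψ E' := by
  classical
  unfold probEvent
  refine Finset.sum_le_sum_of_subset_of_nonneg ?_ fun _ _ _ => by positivity
  intro y hy
  simp only [Finset.mem_filter, Finset.mem_univ, true_and] at hy ⊢
  exact h hy

/-- `Pr[out = 1 ∧ post = 1] ≤ Pr[post = 1]`. [Aaronson 2005, Def. 1] [cite: Aaronson2005, Def. 1] -/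
theorem jointAcceptProb_le_postselectProb (A : Language Bool) (C : QCircuit G (n + m))
    (x : QReg n) : C.jointAcceptProb A x ≤ C.postselectProb A x :=
  probEvent_mono A C _ (jointAcceptEvent_subset_postselectEvent (n + m))

/-- Over a unitary gate set, postselection probabilities are at most `1`.
[Nielsen–Chuang §2.2.5; Aaronson 2005, Def. 1] [cite: Aaronson2005, Def. 1] -/
def postselectProb_le_one : Prop :=
  ∀ (hG : G.IsUnitary) (A : Language Bool) (C : QCircuit G (n + m)) (x : QReg n),
    C.postselectProb A x ≤ 1

/-- Conditional acceptance probabilities are nonnegative. [Aaronson 2005, Def. 1] [cite: Aaronson2005, Def. 1] -/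
theorem condAcceptProb_nonneg (A : Language Bool) (C : QCircuit G (n + m)) (x : QReg n) :
    0 ≤ C.condAcceptProb A x :=
  div_nonneg (jointAcceptProb_nonneg A C x) (postselectProb_nonneg A C x)

/-- Conditional acceptance probabilities are at most `1` (for any gate set: the joint event is
contained in the postselection event; in the junk case `Pr[post = 1] = 0` the value is `0`).
[Aaronson 2005, Def. 1] [cite: Aaronson2005, Def. 1] -/
theorem condAcceptProb_le_one (A : Language Bool) (C : QCircuit G (n + m)) (x : QReg n) :
    C.condAcceptProb A x ≤ 1 :=
  div_le_one_of_le₀ (jointAcceptProb_le_postselectProb A C x) (postselectProb_nonneg A C x)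

end QCircuit

/-! ### Family versions -/

namespace QCircuitFamily

/-- The postselection probability `Pr[post = 1]` of the family on the classical input
`x ∈ {0,1}*` relative to the oracle `A`: run `F.circ |x|` on `|x⟩|0…0⟩` and measure wire `1`.
[Aaronson 2005, Def. 1] [cite: Aaronson2005, Def. 1] -/
noncomputable def postselectProbOn (A : Language Bool) (F : QCircuitFamily G) (x : List Bool) :
    ℝ :=
  (F.circ x.length).postselectProb A x.get

/-- The joint acceptance probability `Pr[out = 1 ∧ post = 1]` of the family on the classical
input `x` relative to the oracle `A`. [Aaronson 2005, Def. 1] [cite: Aaronson2005, Def. 1] -/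
noncomputable def jointAcceptProbOn (A : Language Bool) (F : QCircuitFamily G) (x : List Bool) :
    ℝ :=
  (F.circ x.length).jointAcceptProb A x.get

/-- The conditional acceptance probability `Pr[out = 1 | post = 1]` of the family on the
classical input `x` relative to the oracle `A` (junk `0` when `Pr[post = 1] = 0`, see
`QCircuit.condAcceptProb`). [Aaronson 2005, Def. 1] [cite: Aaronson2005, Def. 1] -/
noncomputable def condAcceptProbOn (A : Language Bool) (F : QCircuitFamily G) (x : List Bool) :
    ℝ :=
  (F.circ x.length).condAcceptProb A x.get

/-- Family postselection probabilities are nonnegative. [Aaronson 2005, Def. 1] [cite: Aaronson2005, Def. 1] -/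
theorem postselectProbOn_nonneg (A : Language Bool) (F : QCircuitFamily G) (x : List Bool) :
    0 ≤ F.postselectProbOn A x :=
  QCircuit.postselectProb_nonneg A _ _

/-- Family conditional acceptance probabilities lie in `[0, 1]`: lower bound.
[Aaronson 2005, Def. 1] [cite: Aaronson2005, Def. 1] -/
theorem condAcceptProbOn_nonneg (A : Language Bool) (F : QCircuitFamily G) (x : List Bool) :
    0 ≤ F.condAcceptProbOn A x :=
  QCircuit.condAcceptProb_nonneg A _ _

/-- Family conditional acceptance probabilities lie in `[0, 1]`: upper bound.
[Aaronson 2005, Def. 1] [cite: Aaronson2005, Def. 1] -/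
theorem condAcceptProbOn_le_one (A : Language Bool) (F : QCircuitFamily G) (x : List Bool) :
    F.condAcceptProbOn A x ≤ 1 :=
  QCircuit.condAcceptProb_le_one A _ _

end QCircuitFamily

/-! ### The classes PostBQP and PostBPP -/

/-- **PostBQP**: bounded-error quantum polynomial time with postselection. `L ∈ PostBQP` iff
there is a poly-time uniform, oracle-free family `F` of Clifford+T circuits such that on every
input `x`: the postselection wire reads `1` with *positive* probability, and conditioned on this,
the output wire reads `1` with probability `≥ 2/3` if `x ∈ L` and `≤ 1/3` if `x ∉ L`.
The gate set is fixed to Clifford+T; for gate sets with algebraic entries the class is the same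
(`= PP`, Aaronson 2005 Thm. 2), but for general real amplitudes it may be larger (Kuperberg 2015,
§2.4). [Aaronson 2005, Def. 1; Kuperberg 2015, §2.4] [cite: Aaronson2005, Def. 1] -/
def PostBQP : Set (Language Bool) :=
  {L | ∃ F : QCircuitFamily cliffordT, F.IsOracleFree ∧ F.IsUniform ∧
    ∀ x, 0 < F.postselectProbOn 0 x ∧
      (x ∈ L → 2 / 3 ≤ F.condAcceptProbOn 0 x) ∧ (x ∉ L → F.condAcceptProbOn 0 x ≤ 1 / 3)}

/-- **PostBPP** (`= BPP_path`): bounded-error probabilistic polynomial time with postselection.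
`L ∈ PostBPP` iff there are polynomial-time predicates `R` (accept) and `S` (postselect) in `P`
and a polynomial `p` such that for every input `x`, with `r` uniform in `{0,1}^{p |x|}`:
`Pr[⟨x,r⟩ ∈ S] > 0`, and `Pr[⟨x,r⟩ ∈ R | ⟨x,r⟩ ∈ S]` is `≥ 2/3` if `x ∈ L` and `≤ 1/3` if
`x ∉ L` (written multiplicatively: `2/3 · Pr[S] ≤ Pr[S ∧ R]`, resp. `Pr[S ∧ R] ≤ 1/3 · Pr[S]`).
Pairing is G01's `boolPair`. [Han–Hemaspaandra–Thierauf 1997, §3 (BPP_path);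
Aaronson 2005, §2 (PostBPP)] [cite: HanHemaspaandraThierauf1997, §3 (BPP_path] -/
def PostBPP : Set (Language Bool) :=
  {L | ∃ R ∈ P, ∃ S ∈ P, ∃ p : Polynomial ℕ, ∀ x : List Bool,
    0 < uniformProb (p.eval x.length) {r : List Bool | boolPair x r ∈ S} ∧
    (x ∈ L → 2 / 3 * uniformProb (p.eval x.length) {r : List Bool | boolPair x r ∈ S} ≤
      uniformProb (p.eval x.length) {r : List Bool | boolPair x r ∈ S ∧ boolPair x r ∈ R}) ∧
    (x ∉ L → uniformProb (p.eval x.length) {r : List Bool | boolPair x r ∈ S ∧ boolPair x r ∈ R} ≤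
      1 / 3 * uniformProb (p.eval x.length) {r : List Bool | boolPair x r ∈ S})}

/-! ### API -/

/-- Unfolding lemma for `PostBQP`. [Aaronson 2005, Def. 1] [cite: Aaronson2005, Def. 1] -/
theorem mem_PostBQP_iff {L : Language Bool} :
    L ∈ PostBQP ↔ ∃ F : QCircuitFamily cliffordT, F.IsOracleFree ∧ F.IsUniform ∧
      ∀ x, 0 < F.postselectProbOn 0 x ∧
        (x ∈ L → 2 / 3 ≤ F.condAcceptProbOn 0 x) ∧ (x ∉ L → F.condAcceptProbOn 0 x ≤ 1 / 3) :=
  Iff.rfl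

/-- `BQP ⊆ PostBQP`: add an ancilla, flip it to `|1⟩` (`X = H S S H` in Clifford+T) and swap it
onto wire `1`, so that postselection is trivial. [Aaronson 2005, §2] [cite: Aaronson2005, §2] -/
def BQP_subset_PostBQP : Prop :=
  BQP ⊆ PostBQP

/-- `BPP ⊆ PostBPP`: take the postselection predicate `S` to be everything (`Set.univ ∈ P`).
[Han–Hemaspaandra–Thierauf 1997, §3; Aaronson 2005, §2] [cite: HanHemaspaandraThierauf1997, §3] -/
def BPP_subset_PostBPP : Prop :=
  BPP ⊆ PostBPP

/-- `PostBPP ⊆ PostBQP`: simulate the two polynomial-time predicates reversibly on a uniform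
superposition over the coin strings (Hadamards on the coin wires). [Aaronson 2005, §2] [cite: Aaronson2005, §2] -/
def PostBPP_subset_PostBQP : Prop :=
  PostBPP ⊆ PostBQP

/-- `PostBPP ⊆ PP` (`BPP_path ⊆ PP`). [Han–Hemaspaandra–Thierauf 1997, Thm. 3.6] [cite: HanHemaspaandraThierauf1997, Thm. 3.6] -/
def PostBPP_subset_PP : Prop :=
  PostBPP ⊆ PP

/-- **Aaronson's theorem**: `PostBQP = PP` (for the gate set Clifford+T, and more generally any
universal gate set with algebraic entries). [Aaronson 2005, Thm. 2; Kuperberg 2015, §2.4] [cite: Aaronson2005, Thm. 2] -/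
def PostBQP_eq_PP : Prop :=
  PostBQP = PP

end Literature.Computability.Cryptography
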